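import Summits.BirchSwinnertonDyer.Uniform.UI.O2UnitLattice
import Summits.BirchSwinnertonDyer.Uniform.UI.O2DenominatorSquare
import HarnessLib

/-!
# Uniform/UI/O2 — the unit `U(P) = Σ²_E(P)/den x(P)` is a PRINCIPAL unit: `U(P) ≡ 1 (mod 3)`

HONEST FRAMING (cell `bsd-uniform`, seat `ui-o2`, gen 8; third of three gen-8 files, after
`O2SigmaNormalisation` and `O2DenominatorSquare`; companion of `O2SigmaValuation` (gen 5) and
`O2UnitAxis` / `O2UnitLattice` (gen 7)): THEOREMS ONLY about the objects of `Uniform/UI/O2.lean` (the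
Tate–sigma value `Σ²_E(P) = tateSigmaValueSq`, SW's height (4.1) `heightFourOneCoord`, the lever's
per-pair input `RegulatorNonvanishingAt W 3`); no definition, no named fact, no `sorry`; everything is
UNCONDITIONAL — the conjecture `TateSigmaIrrationalAtThree` ("C4") is assumed nowhere and stays OPEN;
nothing here proves BSD for any curve, books anything or moves a census mark (PLAN D7: no compute, no
route, no statement change, no new definition).

What this file adds. Gen 5 proved that `U(P) := Σ²_E(P)/den x(P)` is a `3`-adic UNIT with
`ĥ₃(P) = −log₃ U(P)`; gen 7 derived from `ker log₃ ∩ ℤ₃ˣ = {±1}` the statements "up to sign"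
(`ĥ₃(P) = 0 ⟺ Σ² = ±den x`, `U(nP) = ±U(P)^{n²}`) and recorded that "the SIGN of the quadratic law
needs a Tate-curve functional equation not in the tree". The sign is settled here WITHOUT any new
analytic input (§6): **`U(P)` is a PRINCIPAL unit, `‖U(P) − 1‖₃ < 1`**, for every globally minimal `W`
multiplicative at `3`, every `‖q‖₃ < 1` and every rational affine `P = (x, y)` with `‖x‖₃ > 1` — from
`U(P)·num x(P) ≡ 1 (mod p)` at every odd multiplicative `p` (`O2SigmaNormalisation`, the residue of the
unit is the inverse residue of the numerator of `x(P)`) and `num x(P) ≡ 1 (mod 3)` (`O2DenominatorSquare`: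
`den x = e²`, unit squares are `≡ 1 (mod 3)`).

Consequences (§7, `p = 3`, all unconditional):
* `heightFourOneCoord_eq_zero_iff_eq_den` — **`ĥ₃(P) = 0 ⟺ Σ²_E(P) = den x(P)`** (gen 7's `±den x` with
  the sign pinned); on THE datum `pairing_self_eq_zero_iff_eq_den_of_isMultCanonical`; the certificate
  dictionary `regulatorNonvanishingAt_three_iff_forall_admissible_ne_den` / `…_iff_exists_admissible_ne_den`
  (rank one, non-split: `RegulatorNonvanishingAt W 3` ⟺ `Σ²_E(P) ≠ den x(P)` at every ⟺ at ONE admissible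
  point).
* `norm_heightFourOneCoord_eq_norm_sub_one`, `…_eq_norm_x_mul_norm_sub_den`, `norm_heightFourOneCoord_le` —
  **ISOMETRY `‖ĥ₃(P)‖₃ = ‖U(P) − 1‖₃ = ‖x(P)‖₃·‖Σ²_E(P) − den x(P)‖₃ ≤ 3⁻¹`** (`log₃` is an isometry on
  `1 + 3ℤ₃`; tree `norm_padicLog_eq_norm_unitPart_pow_sub_one`): the valuation of the height printed by a
  REG3 certificate row IS the number of `3`-adic digits to which `Σ²_E(Q)` agrees with the INTEGER
  `den x(Q)` beyond the forced `v₃(den x(Q))`; in rank one `‖k‖²·‖Reg₃(E)‖ = ‖x(P)‖·‖Σ²_E(P) − den x(P)‖`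
  (`norm_padicRegulator_mul_sq_eq_of_rank_one`); even the leading digit: `ĥ₃(P) = (1 − U(P))(1 + O(U(P) − 1))`
  (`norm_heightFourOneCoord_sub_one_sub_le`). Schneider at the point = "finite agreement depth"; C4 at the
  point = "`Σ²_E(P)` is not even rational".
* `tateSigmaValueSq_div_den_eq_pow_of_height_eq_mul`, `…_nsmul_eq`, `…_add_torsion_eq` — the EXACT
  quadratic law **`U(nP) = U(P)^{n²}`** and torsion translation `U(P + T) = U(P)` (gen 7 with `±` removed);
  `pow_eq_pow_of_rank_one` — in rank one ANY two admissible points satisfy `U(P₁)^{k₂²} = U(P₂)^{k₁²}`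
  exactly: the unit axis of a rank-one curve carries one invariant.

Not here: the irrationality itself (R1/R2 of the write-up stay OPEN); `p = 2`; the split-prime dictionary.
References: [SteinWuthrich2013] §4.1 eq. (4.1), §4.2, §7; [SilvermanAEC2009] VII.2.2; [MazurSteinTate2006]
§1; [Iwasawa1972PadicL] §4.4; [Schneider1982PadicHeightI] §1; write-up `HOME/ui/O2-CONJECTURE.md` §13.
-/

noncomputable section

open scoped Classical
open IsUltrametricDist
open WeierstrassCurve Literature.NumberTheory.EllipticCurves
open Literature.NumberTheory.EllipticCurves.SteinWuthrich2013
open Literature.NumberTheory.EllipticCurves.Rank1Residual Summit.BirchSwinnertonDyer.Rank1Residual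
open Summit.BirchSwinnertonDyer.Rank1Residual.X11b.ClassClosure

namespace Summit.BirchSwinnertonDyer.Uniform.UI.O2

variable {W : WeierstrassCurve ℚ}

/-! ### §6 THE THEOREM: `U(P) ≡ 1 (mod 3)` -/

/-- **`U(P) = Σ²_E(P)/den x(P)` IS A PRINCIPAL UNIT: `‖U(P) − 1‖₃ < 1`.** For `W/ℚ` globally minimal with
multiplicative reduction at `3`, any `q ∈ ℚ₃` with `‖q‖₃ < 1` and any rational affine `P = (x, y)` with
`‖x‖₃ > 1` (in particular every admissible point of the conjecture `TateSigmaIrrationalAtThree`):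
`U(P) ≡ 1 (mod 3)` (§3: `U·num x ≡ 1`; §5: `num x ≡ 1`). Unconditional (C4 is not assumed); this pins
the sign left open by gen 7 (`O2UnitAxis`/`O2UnitLattice`: `Σ² = ±den x`, `U(nP) = ±U(P)^{n²}`).
[cite: SteinWuthrich2013, §4.1 eq. (4.1), §4.2] [cite: SilvermanAEC2009, VII.2.2] -/
theorem norm_tateSigmaValueSq_div_den_sub_one_lt_one [W.IsElliptic] [W.IsGloballyMinimal]
    (hW : Mult W 3) {q : ℚ_[3]} (hq : ‖q‖ < 1) {x y : ℚ} (hxy : W.toAffine.Nonsingular x y)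
    (hx : 1 < ‖(x : ℚ_[3])‖) :
    ‖tateSigmaValueSq W 3 q x y / ((x.den : ℚ) : ℚ_[3]) - 1‖ < 1 := by
  have hUA := norm_tateSigmaValueSq_div_den_mul_sub_one_lt_one (p := 3) (by decide) hW hq hxy hx
  have hA := norm_x_mul_den_sub_one_lt_one_three hxy hx
  have hA1 : ‖(x : ℚ_[3]) * ((x.den : ℚ) : ℚ_[3])‖ = 1 := norm_eq_one_of_norm_sub_one_lt_one hA
  have hA0 : (x : ℚ_[3]) * ((x.den : ℚ) : ℚ_[3]) ≠ 0 :=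
    norm_pos_iff.mp (by rw [hA1]; exact one_pos)
  have e : tateSigmaValueSq W 3 q x y / ((x.den : ℚ) : ℚ_[3]) =
      tateSigmaValueSq W 3 q x y / ((x.den : ℚ) : ℚ_[3]) * ((x : ℚ_[3]) * ((x.den : ℚ) : ℚ_[3])) /
        ((x : ℚ_[3]) * ((x.den : ℚ) : ℚ_[3])) := by
    rw [mul_div_cancel_right₀ _ hA0]
  rw [e]
  exact norm_div_sub_one_lt_one hUA hA

/-- Discrete form: **`‖U(P) − 1‖₃ ≤ 3⁻¹`**, i.e. `U(P) ∈ 1 + 3ℤ₃`. [cite: SteinWuthrich2013, §4.2] -/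
theorem norm_tateSigmaValueSq_div_den_sub_one_le [W.IsElliptic] [W.IsGloballyMinimal]
    (hW : Mult W 3) {q : ℚ_[3]} (hq : ‖q‖ < 1) {x y : ℚ} (hxy : W.toAffine.Nonsingular x y)
    (hx : 1 < ‖(x : ℚ_[3])‖) :
    ‖tateSigmaValueSq W 3 q x y / ((x.den : ℚ) : ℚ_[3]) - 1‖ ≤ (3 : ℝ)⁻¹ := by
  have h := norm_le_inv_of_norm_lt_one (norm_tateSigmaValueSq_div_den_sub_one_lt_one hW hq hxy hx)
  exact_mod_cast h

/-- **`Σ²_E(P) ≡ den x(P)` to one more `3`-adic digit than its size**: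
`‖Σ²_E(P) − den x(P)‖₃ ≤ 3⁻¹·‖den x(P)‖₃ = 3⁻¹·‖x(P)‖₃⁻¹` (gen 5: `‖Σ²‖₃ = ‖den x‖₃ = ‖x‖₃⁻¹`; here the
leading digits AGREE). [cite: SteinWuthrich2013, §4.2] -/
theorem norm_tateSigmaValueSq_sub_den_le [W.IsElliptic] [W.IsGloballyMinimal]
    (hW : Mult W 3) {q : ℚ_[3]} (hq : ‖q‖ < 1) {x y : ℚ} (hxy : W.toAffine.Nonsingular x y)
    (hx : 1 < ‖(x : ℚ_[3])‖) :
    ‖tateSigmaValueSq W 3 q x y - ((x.den : ℚ) : ℚ_[3])‖ ≤ (3 : ℝ)⁻¹ * ‖(x : ℚ_[3])‖⁻¹ := by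
  have hd0 : ((x.den : ℚ) : ℚ_[3]) ≠ 0 := by exact_mod_cast x.den_nz
  have hdn : ‖((x.den : ℚ) : ℚ_[3])‖ = ‖(x : ℚ_[3])‖⁻¹ := norm_den_eq_inv_norm hx
  have h := norm_tateSigmaValueSq_div_den_sub_one_le hW hq hxy hx
  have e : tateSigmaValueSq W 3 q x y - ((x.den : ℚ) : ℚ_[3]) =
      (tateSigmaValueSq W 3 q x y / ((x.den : ℚ) : ℚ_[3]) - 1) * ((x.den : ℚ) : ℚ_[3]) := by
    field_simp
  rw [e, norm_mul, hdn]
  exact mul_le_mul_of_nonneg_right h (inv_nonneg.mpr (norm_nonneg _))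

/-! ### §7 Consequences at `p = 3`: sign, isometry, exact quadratic law, certificate -/

/-- **`ĥ₃(P) = 0 ⟺ Σ²_E(P) = den x(P)`** — gen 7's `heightFourOneCoord_eq_zero_iff`
(`Σ² = den x ∨ Σ² = −den x`) with the sign PINNED: `U(P) = −1` is impossible for a principal unit
(`‖−1 − 1‖₃ = 1`). Same hypotheses (`W` globally minimal, `Mult W 3`, `‖q‖ < 1`, `‖x‖₃ > 1`); unconditional.
[cite: SteinWuthrich2013, §4.1 eq. (4.1), §4.2] [cite: Schneider1982PadicHeightI, §1] -/
theorem heightFourOneCoord_eq_zero_iff_eq_den [W.IsElliptic] [W.IsGloballyMinimal] (hW : Mult W 3)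
    {q : ℚ_[3]} (hq : ‖q‖ < 1) {x y : ℚ} (hxy : W.toAffine.Nonsingular x y)
    (hx : 1 < ‖(x : ℚ_[3])‖) :
    heightFourOneCoord W 3 q x y = 0 ↔ tateSigmaValueSq W 3 q x y = ((x.den : ℚ) : ℚ_[3]) := by
  rw [heightFourOneCoord_eq_zero_iff hW hq hxy hx]
  refine ⟨?_, Or.inl⟩
  rintro (h | h)
  · exact h
  · exfalso
    have hd0 : ((x.den : ℚ) : ℚ_[3]) ≠ 0 := by exact_mod_cast x.den_nz
    have hU := norm_tateSigmaValueSq_div_den_sub_one_lt_one hW hq hxy hx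
    have h2 : ‖(2 : ℚ_[3])‖ = 1 := by
      simpa using Padic.norm_natCast_eq_one_iff.mpr (show Nat.Coprime 3 2 by decide)
    rw [h, neg_div, div_self hd0, show (-1 : ℚ_[3]) - 1 = -2 by norm_num, norm_neg, h2] at hU
    exact lt_irrefl _ hU

/-- **On THE height datum** (`IsMultCanonical Dh q`, admissible `P = (x, y)`):
`⟨P, P⟩ = 0 ⟺ Σ²_E(P) = den x(P)`. [cite: SteinWuthrich2013, §4.2] [cite: Schneider1982PadicHeightI, §1] -/
theorem pairing_self_eq_zero_iff_eq_den_of_isMultCanonical [W.IsElliptic] [W.IsGloballyMinimal]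
    (hW : Mult W 3) {q : ℚ_[3]} (hq : ‖q‖ < 1) {Dh : PAdicHeightData W 3}
    (hDh : IsMultCanonical Dh q) {x y : ℚ} {h : W.toAffine.Nonsingular x y}
    (hadm : W.IsAdmissible 3 (.some x y h)) :
    Dh.pairing (.some x y h) (.some x y h) = 0 ↔
      tateSigmaValueSq W 3 q x y = ((x.den : ℚ) : ℚ_[3]) := by
  rw [hDh _ hadm]
  exact heightFourOneCoord_eq_zero_iff_eq_den hW hq h hadm.2.1

/-- **ISOMETRY: `‖ĥ₃(P)‖₃ = ‖U(P) − 1‖₃`.** `ĥ₃(P) = −log₃ U(P)` (gen 5), `U(P)` is a principal unit (§6),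
and for a unit `u` of `ℚ₃`, `‖log₃ u‖ = ‖u² − 1‖ = ‖u − 1‖·‖u + 1‖` (tree
`norm_padicLog_eq_norm_unitPart_pow_sub_one`, Iwasawa's isometry on `1 + 3ℤ₃`) with `‖u + 1‖ = ‖2 + (u − 1)‖ = 1`.
So the `3`-adic size of the height IS the `3`-adic distance from `U(P)` to `1`.
[cite: Iwasawa1972PadicL, §4.4] [cite: SteinWuthrich2013, §4.1 eq. (4.1), §4.2] -/
theorem norm_heightFourOneCoord_eq_norm_sub_one [W.IsElliptic] [W.IsGloballyMinimal] (hW : Mult W 3)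
    {q : ℚ_[3]} (hq : ‖q‖ < 1) {x y : ℚ} (hxy : W.toAffine.Nonsingular x y)
    (hx : 1 < ‖(x : ℚ_[3])‖) :
    ‖heightFourOneCoord W 3 q x y‖ = ‖tateSigmaValueSq W 3 q x y / ((x.den : ℚ) : ℚ_[3]) - 1‖ := by
  set U : ℚ_[3] := tateSigmaValueSq W 3 q x y / ((x.den : ℚ) : ℚ_[3]) with hUdef
  have hU1 : ‖U - 1‖ < 1 := norm_tateSigmaValueSq_div_den_sub_one_lt_one hW hq hxy hx
  have hUn : ‖U‖ = 1 := norm_eq_one_of_norm_sub_one_lt_one hU1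
  have hU0 : U ≠ 0 := norm_pos_iff.mp (by rw [hUn]; exact one_pos)
  have hval : U.valuation = 0 := by
    have h := Padic.norm_eq_zpow_neg_valuation hU0
    rw [hUn] at h
    have h' : ((3 : ℕ) : ℝ) ^ (0 : ℤ) = ((3 : ℕ) : ℝ) ^ (-U.valuation) := by rw [zpow_zero]; exact h
    have hinj := zpow_right_injective₀ (by norm_num : (0 : ℝ) < ((3 : ℕ) : ℝ))
      (by norm_num : ((3 : ℕ) : ℝ) ≠ 1) h'
    omega
  have h2 : ‖(2 : ℚ_[3])‖ = 1 := by
    simpa using Padic.norm_natCast_eq_one_iff.mpr (show Nat.Coprime 3 2 by decide)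
  rw [heightFourOneCoord_eq_neg_padicLog_div_den (p := 3) (by decide) hW hq hxy hx, norm_neg, ← hUdef,
    norm_padicLog_eq_norm_unitPart_pow_sub_one (p := 3) (by decide) hU0, hval, neg_zero, zpow_zero,
    mul_one]
  have e : U ^ (3 - 1) - 1 = (U - 1) * (U + 1) := by norm_num; ring
  have hU2 : ‖U + 1‖ = 1 := by
    have e2 : U + 1 = 2 + (U - 1) := by ring
    rw [e2, norm_add_eq_max_of_norm_ne_norm (by rw [h2]; exact hU1.ne'), h2, max_eq_left hU1.le]
  rw [e, norm_mul, hU2, mul_one]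

/-- **`‖ĥ₃(P)‖₃ ≤ 3⁻¹`: SW's height (4.1) of a point with `‖x‖₃ > 1` is divisible by `3`**
(`U(P) ∈ 1 + 3ℤ₃` and the isometry). [cite: SteinWuthrich2013, §4.1 eq. (4.1), §4.2]
[cite: Iwasawa1972PadicL, §4.4] -/
theorem norm_heightFourOneCoord_le [W.IsElliptic] [W.IsGloballyMinimal] (hW : Mult W 3)
    {q : ℚ_[3]} (hq : ‖q‖ < 1) {x y : ℚ} (hxy : W.toAffine.Nonsingular x y)
    (hx : 1 < ‖(x : ℚ_[3])‖) : ‖heightFourOneCoord W 3 q x y‖ ≤ (3 : ℝ)⁻¹ := by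
  rw [norm_heightFourOneCoord_eq_norm_sub_one hW hq hxy hx]
  exact norm_tateSigmaValueSq_div_den_sub_one_le hW hq hxy hx

/-- **AGREEMENT DEPTH: `‖ĥ₃(P)‖₃ = ‖x(P)‖₃ · ‖Σ²_E(P) − den x(P)‖₃`** (`‖U − 1‖ = ‖Σ² − den x‖/‖den x‖`,
`‖den x‖₃ = ‖x‖₃⁻¹`). In valuations: `v₃(ĥ₃(P)) = v₃(Σ²_E(P) − den x(P)) − v₃(den x(P))` — the per-pair
certificate's printed valuation of the height is the number of `3`-adic digits to which the Tate–sigma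
value squared agrees with the INTEGER `den x(P)`, beyond the `v₃(den x)` forced ones; Schneider at the
point says this depth is finite, C4 says `Σ²` is not even rational.
[cite: SteinWuthrich2013, §4.1 eq. (4.1), §4.2, §7] [cite: Schneider1982PadicHeightI, §1] -/
theorem norm_heightFourOneCoord_eq_norm_x_mul_norm_sub_den [W.IsElliptic] [W.IsGloballyMinimal]
    (hW : Mult W 3) {q : ℚ_[3]} (hq : ‖q‖ < 1) {x y : ℚ} (hxy : W.toAffine.Nonsingular x y)
    (hx : 1 < ‖(x : ℚ_[3])‖) :
    ‖heightFourOneCoord W 3 q x y‖ =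
      ‖(x : ℚ_[3])‖ * ‖tateSigmaValueSq W 3 q x y - ((x.den : ℚ) : ℚ_[3])‖ := by
  have hd0 : ((x.den : ℚ) : ℚ_[3]) ≠ 0 := by exact_mod_cast x.den_nz
  have hdn : ‖((x.den : ℚ) : ℚ_[3])‖ = ‖(x : ℚ_[3])‖⁻¹ := norm_den_eq_inv_norm hx
  have hx0 : ‖(x : ℚ_[3])‖ ≠ 0 := (one_pos.trans hx).ne'
  rw [norm_heightFourOneCoord_eq_norm_sub_one hW hq hxy hx]
  have e : tateSigmaValueSq W 3 q x y / ((x.den : ℚ) : ℚ_[3]) - 1 =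
      (tateSigmaValueSq W 3 q x y - ((x.den : ℚ) : ℚ_[3])) / ((x.den : ℚ) : ℚ_[3]) := by
    field_simp
  rw [e, norm_div, hdn, div_inv_eq_mul, mul_comm]

/-- **LEADING DIGIT: `ĥ₃(P) = (1 − U(P))·(1 + O(U(P) − 1))`**, precisely
`‖ĥ₃(P) − (1 − U(P))‖₃ ≤ ‖U(P) − 1‖₃²`: on the principal unit `U(P)` the Iwasawa logarithm IS the series
(tree `padicLog_eq_padicLogSeries`) and `log(1 + t) = t + O(t²)` (tree `norm_padicLogSeries_add_le`, `‖2‖₃ = 1`).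
So not only the valuation but the first significant `3`-adic digit of the height is read off
`(den x(P) − Σ²_E(P))/den x(P)`. [cite: Iwasawa1972PadicL, §4.4] [cite: SteinWuthrich2013, §4.1 eq. (4.1), §4.2] -/
theorem norm_heightFourOneCoord_sub_one_sub_le [W.IsElliptic] [W.IsGloballyMinimal] (hW : Mult W 3)
    {q : ℚ_[3]} (hq : ‖q‖ < 1) {x y : ℚ} (hxy : W.toAffine.Nonsingular x y)
    (hx : 1 < ‖(x : ℚ_[3])‖) :
    ‖heightFourOneCoord W 3 q x y - (1 - tateSigmaValueSq W 3 q x y / ((x.den : ℚ) : ℚ_[3]))‖ ≤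
      ‖tateSigmaValueSq W 3 q x y / ((x.den : ℚ) : ℚ_[3]) - 1‖ ^ 2 := by
  set U : ℚ_[3] := tateSigmaValueSq W 3 q x y / ((x.den : ℚ) : ℚ_[3]) with hUdef
  have hU1 : ‖1 - U‖ < 1 := by
    rw [norm_sub_rev]; exact norm_tateSigmaValueSq_div_den_sub_one_lt_one hW hq hxy hx
  have h2 : ‖(2 : ℚ_[3])⁻¹‖ = 1 := by
    rw [norm_inv, inv_eq_one]
    simpa using Padic.norm_natCast_eq_one_iff.mpr (show Nat.Coprime 3 2 by decide)
  have hlog := norm_padicLogSeries_add_le (p := 3) hU1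
  rw [h2, mul_one, norm_sub_rev] at hlog
  rw [heightFourOneCoord_eq_neg_padicLog_div_den (p := 3) (by decide) hW hq hxy hx, ← hUdef,
    padicLog_eq_padicLogSeries hU1,
    show -padicLogSeries 3 U - (1 - U) = -(padicLogSeries 3 U + (1 - U)) by ring, norm_neg]
  exact hlog

/-- **Equal heights ⟹ EQUAL units (no sign).** For two rational points `P = (x, y)`, `P' = (x', y')` with
`‖x‖₃, ‖x'‖₃ > 1` and `ĥ₃(P') = m·ĥ₃(P)`: `U(P') = U(P)^m` — gen 7's
`tateSigmaValueSq_div_den_eq_or_eq_neg_pow_of_height_eq_mul` with the `±` removed (both sides are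
principal units, §1). [cite: SteinWuthrich2013, §4.2] [cite: Iwasawa1972PadicL, §4.4] -/
theorem tateSigmaValueSq_div_den_eq_pow_of_height_eq_mul [W.IsElliptic] [W.IsGloballyMinimal]
    (hW : Mult W 3) {q : ℚ_[3]} (hq : ‖q‖ < 1) {x y x' y' : ℚ} (hxy : W.toAffine.Nonsingular x y)
    (hx : 1 < ‖(x : ℚ_[3])‖) (hxy' : W.toAffine.Nonsingular x' y') (hx' : 1 < ‖(x' : ℚ_[3])‖) {m : ℕ}
    (hh : heightFourOneCoord W 3 q x' y' = (m : ℚ_[3]) * heightFourOneCoord W 3 q x y) :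
    tateSigmaValueSq W 3 q x' y' / ((x'.den : ℚ) : ℚ_[3]) =
      (tateSigmaValueSq W 3 q x y / ((x.den : ℚ) : ℚ_[3])) ^ m :=
  eq_of_eq_or_eq_neg_of_norm_sub_one_lt_one (p := 3) (by decide)
    (norm_tateSigmaValueSq_div_den_sub_one_lt_one hW hq hxy' hx')
    (norm_pow_sub_one_lt_one (norm_tateSigmaValueSq_div_den_sub_one_lt_one hW hq hxy hx) m)
    (tateSigmaValueSq_div_den_eq_or_eq_neg_pow_of_height_eq_mul hW hq hxy hx hxy' hx' hh)

/-- **THE EXACT QUADRATIC LAW `U(nP) = U(P)^{n²}`** on THE datum (`IsMultCanonical Dh q`; `P` and `nP`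
admissible) — gen 7's `tateSigmaValueSq_div_den_nsmul` without `±`: the `3`-adic shadow, on the Tate–sigma
value squared, of `σ(nP) = ψₙ(P)σ(P)^{n²}` and `den x(nP) = ψₙ(P)² den x(P)^{n²}`, obtained here with NO
functional equation (the residue `U ≡ 1` decides the sign). [cite: MazurSteinTate2006, §1]
[cite: SteinWuthrich2013, §4.2] -/
theorem tateSigmaValueSq_div_den_nsmul_eq [W.IsElliptic] [W.IsGloballyMinimal] (hW : Mult W 3)
    {q : ℚ_[3]} (hq : ‖q‖ < 1) {Dh : PAdicHeightData W 3} (hDh : IsMultCanonical Dh q)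
    {x y : ℚ} {h : W.toAffine.Nonsingular x y} (hadm : W.IsAdmissible 3 (.some x y h)) {n : ℕ}
    {x' y' : ℚ} {h' : W.toAffine.Nonsingular x' y'}
    (hmul : n • (.some x y h : W.toAffine.Point) = .some x' y' h')
    (hadm' : W.IsAdmissible 3 (.some x' y' h')) :
    tateSigmaValueSq W 3 q x' y' / ((x'.den : ℚ) : ℚ_[3]) =
      (tateSigmaValueSq W 3 q x y / ((x.den : ℚ) : ℚ_[3])) ^ (n ^ 2) :=
  eq_of_eq_or_eq_neg_of_norm_sub_one_lt_one (p := 3) (by decide)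
    (norm_tateSigmaValueSq_div_den_sub_one_lt_one hW hq h' hadm'.2.1)
    (norm_pow_sub_one_lt_one (norm_tateSigmaValueSq_div_den_sub_one_lt_one hW hq h hadm.2.1) _)
    (tateSigmaValueSq_div_den_nsmul hW hq hDh hadm hmul hadm')

/-- **EXACT TORSION TRANSLATION `U(P + T) = U(P)`** on THE datum, `T` torsion, `P` and `P + T` admissible
(gen 7's `tateSigmaValueSq_div_den_add_torsion` without `±`). [cite: MazurSteinTate2006, §1]
[cite: SteinWuthrich2013, §4.2] -/
theorem tateSigmaValueSq_div_den_add_torsion_eq [W.IsElliptic] [W.IsGloballyMinimal] (hW : Mult W 3)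
    {q : ℚ_[3]} (hq : ‖q‖ < 1) {Dh : PAdicHeightData W 3} (hDh : IsMultCanonical Dh q)
    {x y : ℚ} {h : W.toAffine.Nonsingular x y} (hadm : W.IsAdmissible 3 (.some x y h))
    {T : W.toAffine.Point} (hT : IsOfFinAddOrder T) {x' y' : ℚ}
    {h' : W.toAffine.Nonsingular x' y'}
    (hsum : (.some x y h : W.toAffine.Point) + T = .some x' y' h')
    (hadm' : W.IsAdmissible 3 (.some x' y' h')) :
    tateSigmaValueSq W 3 q x' y' / ((x'.den : ℚ) : ℚ_[3]) =
      tateSigmaValueSq W 3 q x y / ((x.den : ℚ) : ℚ_[3]) :=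
  eq_of_eq_or_eq_neg_of_norm_sub_one_lt_one (p := 3) (by decide)
    (norm_tateSigmaValueSq_div_den_sub_one_lt_one hW hq h' hadm'.2.1)
    (norm_tateSigmaValueSq_div_den_sub_one_lt_one hW hq h hadm.2.1)
    (tateSigmaValueSq_div_den_add_torsion hW hq hDh hadm hT hsum hadm')

/-- **THE CERTIFICATE, SIGN PINNED (rank one, non-split).** For `W` globally minimal, NON-split
multiplicative at `3`, of Mordell–Weil rank one: `RegulatorNonvanishingAt W 3` ⟺ for every Tate parameter
`q` and every admissible `P = (x, y)`, `Σ²_E(P) ≠ den x(P)` (gen 7's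
`regulatorNonvanishingAt_three_iff_forall_admissible` had "`≠ den x ∧ ≠ −den x`"; the second clause is
automatic by §6). [cite: Schneider1982PadicHeightI, §1] [cite: SteinWuthrich2013, §4.2, Conj. 4.1] -/
theorem regulatorNonvanishingAt_three_iff_forall_admissible_ne_den [W.IsElliptic] [W.IsGloballyMinimal]
    (hW : Mult W 3) (hns : ¬ W.HasSplitMultiplicativeReductionAtPrime 3)
    (hr : W.mordellWeilRank = 1) :
    RegulatorNonvanishingAt W 3 ↔
      ∀ (q : ℚ_[3]), q ≠ 0 → ‖q‖ < 1 → tateJ q = (W.j : ℚ_[3]) →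
      ∀ (x y : ℚ) (h : W.toAffine.Nonsingular x y), W.IsAdmissible 3 (.some x y h) →
        tateSigmaValueSq W 3 q x y ≠ ((x.den : ℚ) : ℚ_[3]) := by
  rw [regulatorNonvanishingAt_three_iff_forall_admissible hW hns hr]
  refine ⟨fun H q hq0 hq1 hj x y h hadm => (H q hq0 hq1 hj x y h hadm).1,
    fun H q hq0 hq1 hj x y h hadm => ⟨H q hq0 hq1 hj x y h hadm, fun hneg => ?_⟩⟩
  have hd0 : ((x.den : ℚ) : ℚ_[3]) ≠ 0 := by exact_mod_cast x.den_nz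
  have hU := norm_tateSigmaValueSq_div_den_sub_one_lt_one hW hq1 h hadm.2.1
  have h2 : ‖(2 : ℚ_[3])‖ = 1 := by
    simpa using Padic.norm_natCast_eq_one_iff.mpr (show Nat.Coprime 3 2 by decide)
  rw [hneg, neg_div, div_self hd0, show (-1 : ℚ_[3]) - 1 = -2 by norm_num, norm_neg, h2] at hU
  exact lt_irrefl _ hU

/-- **ONE ADMISSIBLE POINT DECIDES, SIGN PINNED**: same hypotheses; `RegulatorNonvanishingAt W 3` ⟺ there
are a Tate parameter `q` and ONE admissible `P = (x, y)` with `Σ²_E(P) ≠ den x(P)` — the exact content of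
one REG3 certificate row read on the `Σ²`-axis: "`Σ²_E(Q)` and the integer `den x(Q)` agree to finitely
many `3`-adic digits". [cite: Schneider1982PadicHeightI, §1] [cite: SteinWuthrich2013, §4.2, §7] -/
theorem regulatorNonvanishingAt_three_iff_exists_admissible_ne_den [W.IsElliptic] [W.IsGloballyMinimal]
    (hW : Mult W 3) (hns : ¬ W.HasSplitMultiplicativeReductionAtPrime 3)
    (hr : W.mordellWeilRank = 1) :
    RegulatorNonvanishingAt W 3 ↔
      ∃ (q : ℚ_[3]), q ≠ 0 ∧ ‖q‖ < 1 ∧ tateJ q = (W.j : ℚ_[3]) ∧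
      ∃ (x y : ℚ) (h : W.toAffine.Nonsingular x y), W.IsAdmissible 3 (.some x y h) ∧
        tateSigmaValueSq W 3 q x y ≠ ((x.den : ℚ) : ℚ_[3]) := by
  rw [regulatorNonvanishingAt_three_iff_exists_admissible hW hns hr]
  constructor
  · rintro ⟨q, hq0, hq1, hj, x, y, h, hadm, hne, -⟩
    exact ⟨q, hq0, hq1, hj, x, y, h, hadm, hne⟩
  · rintro ⟨q, hq0, hq1, hj, x, y, h, hadm, hne⟩
    refine ⟨q, hq0, hq1, hj, x, y, h, hadm, hne, fun hneg => ?_⟩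
    have hd0 : ((x.den : ℚ) : ℚ_[3]) ≠ 0 := by exact_mod_cast x.den_nz
    have hU := norm_tateSigmaValueSq_div_den_sub_one_lt_one hW hq1 h hadm.2.1
    have h2 : ‖(2 : ℚ_[3])‖ = 1 := by
      simpa using Padic.norm_natCast_eq_one_iff.mpr (show Nat.Coprime 3 2 by decide)
    rw [hneg, neg_div, div_self hd0, show (-1 : ℚ_[3]) - 1 = -2 by norm_num, norm_neg, h2] at hU
    exact lt_irrefl _ hU


/-! ### §8 Rank one: the regulator's valuation and ONE invariant on the unit axis -/

/-- **The REG3 certificate's number on the `Σ²`-axis (rank one).** For `W` globally minimal,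
multiplicative at `3`, of Mordell–Weil rank one, THE datum `Dh` (`IsMultCanonical Dh q`) and an admissible
`P = (x, y)`: there is `k ∈ ℤ`, `k ≠ 0` (`P ≡ k·P₀` mod torsion) with
`‖k‖₃² · ‖Reg₃(E, Dh)‖₃ = ‖x(P)‖₃ · ‖Σ²_E(P) − den x(P)‖₃` (`⟨P, P⟩ = k²·Reg₃` and §7's isometry).
So `v₃(Reg₃) = [agreement depth of Σ²_E(P) with den x(P)] − v₃(den x(P)) − 2v₃(k)`.
[cite: SteinWuthrich2013, §4.2, §4.4, §7] [cite: Schneider1982PadicHeightI, §1] -/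
theorem norm_padicRegulator_mul_sq_eq_of_rank_one [W.IsElliptic] [W.IsGloballyMinimal] (hW : Mult W 3)
    {q : ℚ_[3]} (hq : ‖q‖ < 1) (hr : W.mordellWeilRank = 1) {Dh : PAdicHeightData W 3}
    (hDh : IsMultCanonical Dh q) {x y : ℚ} {h : W.toAffine.Nonsingular x y}
    (hadm : W.IsAdmissible 3 (.some x y h)) :
    ∃ k : ℤ, k ≠ 0 ∧
      ‖(k : ℚ_[3])‖ ^ 2 * ‖padicRegulator Dh‖ =
        ‖(x : ℚ_[3])‖ * ‖tateSigmaValueSq W 3 q x y - ((x.den : ℚ) : ℚ_[3])‖ := by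
  obtain ⟨P₀, -, hRegeq, hgen⟩ := exists_generator_of_rank_one hr Dh
  obtain ⟨k, hk, hk0⟩ := hgen (.some x y h)
  refine ⟨k, fun h0 => hadm.1 (hk0 h0), ?_⟩
  have hP : Dh.pairing (.some x y h) (.some x y h) = heightFourOneCoord W 3 q x y := hDh _ hadm
  rw [← norm_heightFourOneCoord_eq_norm_x_mul_norm_sub_den hW hq h hadm.2.1, ← hP, hk, ← hRegeq,
    norm_mul, norm_pow]

/-- **ONE INVARIANT PER RANK-ONE CURVE.** Same setting; for ANY two admissible points `P₁ = (x₁, y₁)`,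
`P₂ = (x₂, y₂)` (with `Pᵢ ≡ kᵢ·P₀` mod torsion, `kᵢ ≠ 0`): **`U(P₁)^{k₂²} = U(P₂)^{k₁²}` EXACTLY**
(`k₂²⟨P₁, P₁⟩ = k₁²k₂² Reg₃ = k₁²⟨P₂, P₂⟩`, `ĥ = −log₃ U`, and two principal units with the same `log₃`
are equal). All admissible `U`-values of the curve are thus rational powers of one another: the unit axis
carries a single invariant, of which REG3 certifies "`≠ 1`" and C4 conjectures "no power is rational"
(gen 7's `forall_admissible_iff_forall_pow_ne_ratCast`). [cite: MazurSteinTate2006, §1]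
[cite: SteinWuthrich2013, §4.2] [cite: Iwasawa1972PadicL, §4.4] -/
theorem pow_eq_pow_of_rank_one [W.IsElliptic] [W.IsGloballyMinimal] (hW : Mult W 3) {q : ℚ_[3]}
    (hq : ‖q‖ < 1) (hr : W.mordellWeilRank = 1) {Dh : PAdicHeightData W 3} (hDh : IsMultCanonical Dh q)
    {x₁ y₁ x₂ y₂ : ℚ} {h₁ : W.toAffine.Nonsingular x₁ y₁} {h₂ : W.toAffine.Nonsingular x₂ y₂}
    (hadm₁ : W.IsAdmissible 3 (.some x₁ y₁ h₁)) (hadm₂ : W.IsAdmissible 3 (.some x₂ y₂ h₂)) :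
    ∃ k₁ k₂ : ℤ, k₁ ≠ 0 ∧ k₂ ≠ 0 ∧
      (tateSigmaValueSq W 3 q x₁ y₁ / ((x₁.den : ℚ) : ℚ_[3])) ^ (k₂.natAbs ^ 2) =
        (tateSigmaValueSq W 3 q x₂ y₂ / ((x₂.den : ℚ) : ℚ_[3])) ^ (k₁.natAbs ^ 2) := by
  obtain ⟨P₀, -, -, hgen⟩ := exists_generator_of_rank_one hr Dh
  obtain ⟨k₁, hk₁, hk₁0⟩ := hgen (.some x₁ y₁ h₁)
  obtain ⟨k₂, hk₂, hk₂0⟩ := hgen (.some x₂ y₂ h₂)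
  refine ⟨k₁, k₂, fun h0 => hadm₁.1 (hk₁0 h0), fun h0 => hadm₂.1 (hk₂0 h0), ?_⟩
  set U₁ : ℚ_[3] := tateSigmaValueSq W 3 q x₁ y₁ / ((x₁.den : ℚ) : ℚ_[3]) with hU₁def
  set U₂ : ℚ_[3] := tateSigmaValueSq W 3 q x₂ y₂ / ((x₂.den : ℚ) : ℚ_[3]) with hU₂def
  have hU₁p : ‖U₁ - 1‖ < 1 := norm_tateSigmaValueSq_div_den_sub_one_lt_one hW hq h₁ hadm₁.2.1
  have hU₂p : ‖U₂ - 1‖ < 1 := norm_tateSigmaValueSq_div_den_sub_one_lt_one hW hq h₂ hadm₂.2.1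
  have hU₁n : ‖U₁‖ = 1 := norm_eq_one_of_norm_sub_one_lt_one hU₁p
  have hU₂n : ‖U₂‖ = 1 := norm_eq_one_of_norm_sub_one_lt_one hU₂p
  have hU₁0 : U₁ ≠ 0 := norm_pos_iff.mp (by rw [hU₁n]; exact one_pos)
  have hU₂0 : U₂ ≠ 0 := norm_pos_iff.mp (by rw [hU₂n]; exact one_pos)
  -- the heights: `ĥ(Pᵢ) = kᵢ² Reg = −log₃ Uᵢ`
  have hP₁ : Dh.pairing (.some x₁ y₁ h₁) (.some x₁ y₁ h₁) = heightFourOneCoord W 3 q x₁ y₁ :=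
    hDh _ hadm₁
  have hP₂ : Dh.pairing (.some x₂ y₂ h₂) (.some x₂ y₂ h₂) = heightFourOneCoord W 3 q x₂ y₂ :=
    hDh _ hadm₂
  have hh₁ : heightFourOneCoord W 3 q x₁ y₁ = ((k₁ : ℚ_[3]) ^ 2) * Dh.pairing P₀ P₀ := by
    rw [← hP₁]; exact hk₁
  have hh₂ : heightFourOneCoord W 3 q x₂ y₂ = ((k₂ : ℚ_[3]) ^ 2) * Dh.pairing P₀ P₀ := by
    rw [← hP₂]; exact hk₂
  rw [heightFourOneCoord_eq_neg_padicLog_div_den (p := 3) (by decide) hW hq h₁ hadm₁.2.1, ← hU₁def] at hh₁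
  rw [heightFourOneCoord_eq_neg_padicLog_div_den (p := 3) (by decide) hW hq h₂ hadm₂.2.1, ← hU₂def] at hh₂
  have hcast : ∀ k : ℤ, ((k.natAbs ^ 2 : ℕ) : ℚ_[3]) = (k : ℚ_[3]) ^ 2 := by
    intro k
    rw [Nat.cast_pow, ← Int.cast_natCast, ← Int.cast_pow, Int.natAbs_sq, Int.cast_pow]
  have hlog : padicLog 3 (U₁ ^ (k₂.natAbs ^ 2)) = padicLog 3 (U₂ ^ (k₁.natAbs ^ 2)) := by
    rw [padicLog_pow_three hU₁0, padicLog_pow_three hU₂0, hcast, hcast]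
    linear_combination (k₁ : ℚ_[3]) ^ 2 * hh₂ - (k₂ : ℚ_[3]) ^ 2 * hh₁
  have hn₁ : ‖U₁ ^ (k₂.natAbs ^ 2)‖ = 1 := by rw [norm_pow, hU₁n, one_pow]
  have hn₂ : ‖U₂ ^ (k₁.natAbs ^ 2)‖ = 1 := by rw [norm_pow, hU₂n, one_pow]
  exact eq_of_eq_or_eq_neg_of_norm_sub_one_lt_one (p := 3) (by decide)
    (norm_pow_sub_one_lt_one hU₁p _) (norm_pow_sub_one_lt_one hU₂p _)
    (eq_or_eq_neg_of_norm_eq_one_of_padicLog_eq hn₁ hn₂ hlog)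

end Summit.BirchSwinnertonDyer.Uniform.UI.O2

end
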